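import Summits.NavierStokesRegularity.NavierStokesRegularity.Theses.OddMorawetz
import Summits.NavierStokesRegularity.NavierStokesRegularity.Theorems.OddMorawetzOddMorawetzLocalStubFluxTransfer
import Summits.NavierStokesRegularity.NavierStokesRegularity.Theorems.OddMorawetzOddMorawetzLocalStubJetDecay
import HarnessLib.Audit

/-!
# Birth skeleton (BC3) of the crux `OddMorawetz.OddMorawetzLocal`

(crux item `stmt-NavierStokesRegularity-1376`, rank 2, route `route-NavierStokesRegularity-OddMorawetz`;
tree path `Cruxes/OddMorawetzLocal/Lines/birth.lean`; registrar `planner-skel-stmt-NavierStokesRegularity-1376-0`,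
2026-08-17. The route predates the Lean birth certificate; this file supplies BC3 retroactively.)

THE CRUX (fixed, by name). `OddMorawetzLocal`: ∃ k ≤ 5 and a smooth density `m` on 3-jets, pointwise a cubic form
(`m (μ•z) = μ³ m z`) of derivative weight `k` (`m (z₀, s•z₁, s²•z₂, s³•z₃) = sᵏ m z`), whose EULER DERIVATIVE
`Q_m(v) = −∫ Dm(Jv)[J B(v,v)]` (`B = eulerBilinear`, pressure included) is `≥ 0` on every divergence-free Schwartz field
and `> 0` on one — a local odd Morawetz functional for 3-D Euler.

THE CUT — algebra / harmonic analysis / calculus. How does anyone prove `∫ (quartic local expression in v and its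
pressure) ≥ 0` for all divergence-free `v`? By a LOCAL CERTIFICATE: the integrand is a pointwise-nonnegative function
of the jets plus a total divergence (S-procedure / SOS-modulo-null-Lagrangians — the route's own "SOS/SDP with the
exact pressure symbol", here in x-space: the pressure enters through the jets of `b = B(v,v) = −(v·∇)v − ∇p`, so the
pointwise identity is demanded only on the constrained set {div v = 0, b = Leray projection}, multipliers implicit).
Then the flux integrates to zero because the jets of `B(v,v)` decay like `|x|⁻⁴` for Schwartz divergence-free `v`.

* `stub_localCertificate` [XL, OPEN — THE HUNT in decidable local form; strictly STRONGER than the crux's sign clause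
  (a nonnegative nonlocal quartic form need not admit a local certificate), so this is a transfer `C⁺ → C` whose
  why-easier is: pointwise polynomial algebra on a finite-dimensional jet space, an SDP for a polynomial ansatz]:
  ∃ k ≤ 5, an admissible density `m` (the crux's three structural clauses verbatim), a smooth `σ ≥ 0` on pairs of
  4-jets and a smooth flux `Φ` on pairs of 3-jets with the POINTWISE identity
  `−Dm(Jv x)[J b x] = σ(J₄v x, J₄b x) + div_x Φ(Jv, Jb)(x)` for every divergence-free Schwartz `v` (`b = B(v,v)`) and
  every `x`, and ONE divergence-free Schwartz `v₀` and point `x₀` with `σ(J₄v₀ x₀, J₄b₀ x₀) > 0`.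
  Why it might fail: exactly the crux's risk (order 3 is indefinite — support `OrderThreeIndefinite`, proved; order 5
  may be SDP-infeasible), sharpened: even a genuinely nonnegative `Q_m` may lack a LOCAL certificate at flux order 3
  (raise the flux order / pass to the Fourier-side certificate as the first restate).
* `stub_jetDecay` [L, TRUE in print — harmonic analysis of the Leray projection]: for Schwartz divergence-free `v`,
  `b = B(v,v)` is smooth (in tree: `contDiff_eulerBilinear_holds`) and `(1+|x|)⁴ |∇ⁿ b(x)| ≤ C` for `n ≤ 4`
(`b = −(v·∇)v − ∇p` with `Δp = −∂ᵢ∂ⱼ(vᵢvⱼ)`, a double divergence, so `p = O(|x|⁻³)`, `∇p = O(|x|⁻⁴)` and each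
  further derivative gains one order; Tao 2016 §1 "O(|x|^{-d-1})", quoted in the docstring of `eulerBilinear`; in tree
  so far only `eulerBilinear_regular`: continuous, integrable, integrable Fourier transform).
* `stub_fluxTransfer` [M, TRUE — calculus on ℝ³]: for Schwartz `v`, a smooth `b` with that decay, smooth `m σ Φ`,
  `σ ≥ 0`, the pointwise identity integrates: `σ(J₄v, J₄b) ∈ L¹` and `−∫ Dm(Jv)[Jb] = ∫ σ(J₄v, J₄b)` (whole-space
  divergence theorem: `Φ(Jv, Jb) − Φ(0,0) = O(|x|⁻⁴)`, so the flux through large boxes vanishes; Mathlib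
  `integral_divergence_of_hasFDerivAt_off_countable` on boxes + dominated convergence).

The jet maps are passed to the stubs as parameters `J`, `J4` pinned by their defining equations (so every stub is
stated over existing declarations only; no local definition enters a registered signature).

`OddMorawetzLocal_of : Theses.OddMorawetz.OddMorawetzLocal` is the ONLY theorem here concluding the crux (BY NAME, no
hypotheses, placeholders only inside the three declared stubs, each used by name): pin `J`, `J4`; take the certificate;
for every divergence-free Schwartz `v` feed `stub_jetDecay` into `stub_fluxTransfer` to get `Q_m(v) = ∫ σ ≥ 0`
(`integral_nonneg`); at `v₀` the integrand is continuous (Schwartz `v₀`, smooth `b₀`, smooth `σ`), nonnegative and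
positive at `x₀`, so its support is a non-empty open set of positive Lebesgue measure and `Q_m(v₀) = ∫ σ > 0`
(`integral_pos_iff_support_of_nonneg`). Its CLOSED twin with the three stub statements as hypotheses (same proof, no
placeholder anywhere) is the registrar's evidence file `bc/OddMorawetzLocal_birth_closed.lean`.

BC3 PROBES (registrar's folder `bc/probe_*.lean`): for each stub `S`, `S → OddMorawetzLocal` and
`S → NavierStokesRegularity` by `first | exact? | simpa | aesop` FAIL — no stub is cheaply the crux or the summit.

Disproof used: none on file for this crux (`ledger crux ls`: no `Disproof.lean`, no `Negative/`). Refuter notes honoured: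
the Bochner loophole is closed in the repaired signature (cubic-form clause forces `m 0 = 0`), and `stub_localCertificate`
contains NO integral at all (pure pointwise algebra), so no Bochner junk value can satisfy it; the Gavrilov steady-state
constraint (`B(v_G,v_G) = 0 ⇒ Q(v_G) = 0 = min Q`) is a linear side condition any certificate automatically meets.
-/

noncomputable section

open MeasureTheory
open Literature.Analysis.FluidPDE

namespace Summit.NavierStokesRegularity.NavierStokesRegularity.Cruxes.OddMorawetzLocal.Birth

set_option linter.unusedVariables false
set_option linter.dupNamespace false

/-- **stub 1 — `stub_localCertificate` (XL, OPEN; the hunt in local S-procedure form, a transfer `C⁺ → C`).**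
A local SOS-modulo-divergence certificate for the Euler derivative of an admissible odd cubic density of order `k ≤ 5`,
with a strictness witness. `J`, `J4` are the 3-jet / 4-jet maps, pinned by their defining equations. -/
theorem stub_localCertificate :
    ∀ (J : (EuclideanSpace ℝ (Fin 3) → EuclideanSpace ℝ (Fin 3)) → EuclideanSpace ℝ (Fin 3) → EuclideanSpace ℝ (Fin 3) × (EuclideanSpace ℝ (Fin 3) [×1]→L[ℝ] EuclideanSpace ℝ (Fin 3)) × (EuclideanSpace ℝ (Fin 3) [×2]→L[ℝ] EuclideanSpace ℝ (Fin 3)) × (EuclideanSpace ℝ (Fin 3) [×3]→L[ℝ] EuclideanSpace ℝ (Fin 3)))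
      (J4 : (EuclideanSpace ℝ (Fin 3) → EuclideanSpace ℝ (Fin 3)) → EuclideanSpace ℝ (Fin 3) → EuclideanSpace ℝ (Fin 3) × (EuclideanSpace ℝ (Fin 3) [×1]→L[ℝ] EuclideanSpace ℝ (Fin 3)) × (EuclideanSpace ℝ (Fin 3) [×2]→L[ℝ] EuclideanSpace ℝ (Fin 3)) × (EuclideanSpace ℝ (Fin 3) [×3]→L[ℝ] EuclideanSpace ℝ (Fin 3)) × (EuclideanSpace ℝ (Fin 3) [×4]→L[ℝ] EuclideanSpace ℝ (Fin 3))),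
      (∀ v x, J v x = (v x, iteratedFDeriv ℝ 1 v x, iteratedFDeriv ℝ 2 v x, iteratedFDeriv ℝ 3 v x)) →
      (∀ v x, J4 v x = (v x, iteratedFDeriv ℝ 1 v x, iteratedFDeriv ℝ 2 v x, iteratedFDeriv ℝ 3 v x,
        iteratedFDeriv ℝ 4 v x)) →
      ∃ (k : ℕ) (m : EuclideanSpace ℝ (Fin 3) × (EuclideanSpace ℝ (Fin 3) [×1]→L[ℝ] EuclideanSpace ℝ (Fin 3)) × (EuclideanSpace ℝ (Fin 3) [×2]→L[ℝ] EuclideanSpace ℝ (Fin 3)) × (EuclideanSpace ℝ (Fin 3) [×3]→L[ℝ] EuclideanSpace ℝ (Fin 3)) → ℝ)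
        (σ : (EuclideanSpace ℝ (Fin 3) × (EuclideanSpace ℝ (Fin 3) [×1]→L[ℝ] EuclideanSpace ℝ (Fin 3)) × (EuclideanSpace ℝ (Fin 3) [×2]→L[ℝ] EuclideanSpace ℝ (Fin 3)) × (EuclideanSpace ℝ (Fin 3) [×3]→L[ℝ] EuclideanSpace ℝ (Fin 3)) × (EuclideanSpace ℝ (Fin 3) [×4]→L[ℝ] EuclideanSpace ℝ (Fin 3))) × (EuclideanSpace ℝ (Fin 3) × (EuclideanSpace ℝ (Fin 3) [×1]→L[ℝ] EuclideanSpace ℝ (Fin 3)) × (EuclideanSpace ℝ (Fin 3) [×2]→L[ℝ] EuclideanSpace ℝ (Fin 3)) × (EuclideanSpace ℝ (Fin 3) [×3]→L[ℝ] EuclideanSpace ℝ (Fin 3)) × (EuclideanSpace ℝ (Fin 3) [×4]→L[ℝ] EuclideanSpace ℝ (Fin 3))) → ℝ)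
        (Φ : (EuclideanSpace ℝ (Fin 3) × (EuclideanSpace ℝ (Fin 3) [×1]→L[ℝ] EuclideanSpace ℝ (Fin 3)) × (EuclideanSpace ℝ (Fin 3) [×2]→L[ℝ] EuclideanSpace ℝ (Fin 3)) × (EuclideanSpace ℝ (Fin 3) [×3]→L[ℝ] EuclideanSpace ℝ (Fin 3))) × (EuclideanSpace ℝ (Fin 3) × (EuclideanSpace ℝ (Fin 3) [×1]→L[ℝ] EuclideanSpace ℝ (Fin 3)) × (EuclideanSpace ℝ (Fin 3) [×2]→L[ℝ] EuclideanSpace ℝ (Fin 3)) × (EuclideanSpace ℝ (Fin 3) [×3]→L[ℝ] EuclideanSpace ℝ (Fin 3))) → EuclideanSpace ℝ (Fin 3)),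
        k ≤ 5 ∧ ContDiff ℝ (⊤ : ℕ∞) m ∧ (∀ (μ : ℝ) z, m (μ • z) = μ ^ 3 * m z) ∧
        (∀ (s : ℝ), 0 < s → ∀ z₀ z₁ z₂ z₃,
            m (z₀, s • z₁, (s ^ 2) • z₂, (s ^ 3) • z₃) = s ^ k * m (z₀, z₁, z₂, z₃)) ∧
        ContDiff ℝ (⊤ : ℕ∞) σ ∧ ContDiff ℝ (⊤ : ℕ∞) Φ ∧ (∀ z, 0 ≤ σ z) ∧
        (∀ v, Literature.Analysis.FluidPDE.IsSchwartzField v → Literature.Analysis.FluidPDE.VectorCalculus.IsDivFree v → ∀ x,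
            -(fderiv ℝ m (J v x) (J (Literature.Analysis.FluidPDE.eulerBilinear v v) x)) =
              σ (J4 v x, J4 (Literature.Analysis.FluidPDE.eulerBilinear v v) x) +
                Literature.Analysis.FluidPDE.VectorCalculus.divergence (fun y => Φ (J v y, J (Literature.Analysis.FluidPDE.eulerBilinear v v) y)) x) ∧
        (∃ v, Literature.Analysis.FluidPDE.IsSchwartzField v ∧ Literature.Analysis.FluidPDE.VectorCalculus.IsDivFree v ∧
            ∃ x, 0 < σ (J4 v x, J4 (Literature.Analysis.FluidPDE.eulerBilinear v v) x)) := by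
  sorry

/-- **stub 2 — `stub_jetDecay` (L, true in print; harmonic analysis of the Leray-projected nonlinearity).**
For a divergence-free Schwartz field `v`, `B(v,v)` is smooth and its derivatives of order `≤ 4` decay like `|x|⁻⁴`
(Tao 2016 §1: `P div(v ⊗ v) = O(|x|^{-d-1})`; smoothness is the tree fact `contDiff_eulerBilinear_holds`). -/
theorem stub_jetDecay :
    ∀ v : EuclideanSpace ℝ (Fin 3) → EuclideanSpace ℝ (Fin 3),
      Literature.Analysis.FluidPDE.IsSchwartzField v → Literature.Analysis.FluidPDE.VectorCalculus.IsDivFree v →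
      ContDiff ℝ (⊤ : ℕ∞) (Literature.Analysis.FluidPDE.eulerBilinear v v) ∧
        ∃ C : ℝ, ∀ n : ℕ, n ≤ 4 → ∀ x : EuclideanSpace ℝ (Fin 3),
          (1 + ‖x‖) ^ 4 * ‖iteratedFDeriv ℝ n (Literature.Analysis.FluidPDE.eulerBilinear v v) x‖ ≤ C :=
  -- LANDED: p148706 (Theorems/OddMorawetzOddMorawetzLocalStubJetDecay.lean)
  Summit.NavierStokesRegularity.NavierStokesRegularity.Theorems.stub_jetDecay

/-- **stub 3 — `stub_fluxTransfer` (M, true; whole-space divergence theorem with `|x|⁻⁴` tails).**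
A pointwise identity `−Dm(Jv)[Jb] = σ(J₄v, J₄b) + div Φ(Jv, Jb)` with smooth data, `σ ≥ 0`, Schwartz `v` and a smooth
`b` with `(1+|x|)⁴`-decay of its jets of order `≤ 4` integrates to `−∫ Dm(Jv)[Jb] = ∫ σ(J₄v, J₄b)` (and the latter
integrand is integrable): the flux of `Φ(Jv, Jb) − Φ(0,0) = O(|x|⁻⁴)` through large boxes vanishes. -/
theorem stub_fluxTransfer :
    ∀ (J : (EuclideanSpace ℝ (Fin 3) → EuclideanSpace ℝ (Fin 3)) → EuclideanSpace ℝ (Fin 3) → EuclideanSpace ℝ (Fin 3) × (EuclideanSpace ℝ (Fin 3) [×1]→L[ℝ] EuclideanSpace ℝ (Fin 3)) × (EuclideanSpace ℝ (Fin 3) [×2]→L[ℝ] EuclideanSpace ℝ (Fin 3)) × (EuclideanSpace ℝ (Fin 3) [×3]→L[ℝ] EuclideanSpace ℝ (Fin 3)))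
      (J4 : (EuclideanSpace ℝ (Fin 3) → EuclideanSpace ℝ (Fin 3)) → EuclideanSpace ℝ (Fin 3) → EuclideanSpace ℝ (Fin 3) × (EuclideanSpace ℝ (Fin 3) [×1]→L[ℝ] EuclideanSpace ℝ (Fin 3)) × (EuclideanSpace ℝ (Fin 3) [×2]→L[ℝ] EuclideanSpace ℝ (Fin 3)) × (EuclideanSpace ℝ (Fin 3) [×3]→L[ℝ] EuclideanSpace ℝ (Fin 3)) × (EuclideanSpace ℝ (Fin 3) [×4]→L[ℝ] EuclideanSpace ℝ (Fin 3))),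
      (∀ v x, J v x = (v x, iteratedFDeriv ℝ 1 v x, iteratedFDeriv ℝ 2 v x, iteratedFDeriv ℝ 3 v x)) →
      (∀ v x, J4 v x = (v x, iteratedFDeriv ℝ 1 v x, iteratedFDeriv ℝ 2 v x, iteratedFDeriv ℝ 3 v x,
        iteratedFDeriv ℝ 4 v x)) →
      ∀ (m : EuclideanSpace ℝ (Fin 3) × (EuclideanSpace ℝ (Fin 3) [×1]→L[ℝ] EuclideanSpace ℝ (Fin 3)) × (EuclideanSpace ℝ (Fin 3) [×2]→L[ℝ] EuclideanSpace ℝ (Fin 3)) × (EuclideanSpace ℝ (Fin 3) [×3]→L[ℝ] EuclideanSpace ℝ (Fin 3)) → ℝ)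
        (σ : (EuclideanSpace ℝ (Fin 3) × (EuclideanSpace ℝ (Fin 3) [×1]→L[ℝ] EuclideanSpace ℝ (Fin 3)) × (EuclideanSpace ℝ (Fin 3) [×2]→L[ℝ] EuclideanSpace ℝ (Fin 3)) × (EuclideanSpace ℝ (Fin 3) [×3]→L[ℝ] EuclideanSpace ℝ (Fin 3)) × (EuclideanSpace ℝ (Fin 3) [×4]→L[ℝ] EuclideanSpace ℝ (Fin 3))) × (EuclideanSpace ℝ (Fin 3) × (EuclideanSpace ℝ (Fin 3) [×1]→L[ℝ] EuclideanSpace ℝ (Fin 3)) × (EuclideanSpace ℝ (Fin 3) [×2]→L[ℝ] EuclideanSpace ℝ (Fin 3)) × (EuclideanSpace ℝ (Fin 3) [×3]→L[ℝ] EuclideanSpace ℝ (Fin 3)) × (EuclideanSpace ℝ (Fin 3) [×4]→L[ℝ] EuclideanSpace ℝ (Fin 3))) → ℝ)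
        (Φ : (EuclideanSpace ℝ (Fin 3) × (EuclideanSpace ℝ (Fin 3) [×1]→L[ℝ] EuclideanSpace ℝ (Fin 3)) × (EuclideanSpace ℝ (Fin 3) [×2]→L[ℝ] EuclideanSpace ℝ (Fin 3)) × (EuclideanSpace ℝ (Fin 3) [×3]→L[ℝ] EuclideanSpace ℝ (Fin 3))) × (EuclideanSpace ℝ (Fin 3) × (EuclideanSpace ℝ (Fin 3) [×1]→L[ℝ] EuclideanSpace ℝ (Fin 3)) × (EuclideanSpace ℝ (Fin 3) [×2]→L[ℝ] EuclideanSpace ℝ (Fin 3)) × (EuclideanSpace ℝ (Fin 3) [×3]→L[ℝ] EuclideanSpace ℝ (Fin 3))) → EuclideanSpace ℝ (Fin 3))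
        (v b : EuclideanSpace ℝ (Fin 3) → EuclideanSpace ℝ (Fin 3)),
        ContDiff ℝ (⊤ : ℕ∞) m → ContDiff ℝ (⊤ : ℕ∞) σ → ContDiff ℝ (⊤ : ℕ∞) Φ → (∀ z, 0 ≤ σ z) →
        Literature.Analysis.FluidPDE.IsSchwartzField v → ContDiff ℝ (⊤ : ℕ∞) b →
        (∃ C : ℝ, ∀ n : ℕ, n ≤ 4 → ∀ x : EuclideanSpace ℝ (Fin 3), (1 + ‖x‖) ^ 4 * ‖iteratedFDeriv ℝ n b x‖ ≤ C) →
        (∀ x, -(fderiv ℝ m (J v x) (J b x)) = σ (J4 v x, J4 b x) + Literature.Analysis.FluidPDE.VectorCalculus.divergence (fun y => Φ (J v y, J b y)) x) →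
        MeasureTheory.Integrable (fun x => σ (J4 v x, J4 b x)) ∧
          -∫ x, fderiv ℝ m (J v x) (J b x) = ∫ x, σ (J4 v x, J4 b x) :=
  -- LANDED: p147321 (Theorems/OddMorawetzOddMorawetzLocalStubFluxTransfer.lean)
  Summit.NavierStokesRegularity.NavierStokesRegularity.Theorems.stub_fluxTransfer

/-- The 3-jet map of the crux (`J` of `OddMorawetzLocal`), used only inside the composition below. -/
def jet3 (v : EuclideanSpace ℝ (Fin 3) → EuclideanSpace ℝ (Fin 3)) (x : EuclideanSpace ℝ (Fin 3)) :
    EuclideanSpace ℝ (Fin 3) × (EuclideanSpace ℝ (Fin 3) [×1]→L[ℝ] EuclideanSpace ℝ (Fin 3)) × (EuclideanSpace ℝ (Fin 3) [×2]→L[ℝ] EuclideanSpace ℝ (Fin 3)) × (EuclideanSpace ℝ (Fin 3) [×3]→L[ℝ] EuclideanSpace ℝ (Fin 3)) :=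
  (v x, iteratedFDeriv ℝ 1 v x, iteratedFDeriv ℝ 2 v x, iteratedFDeriv ℝ 3 v x)

/-- The 4-jet map (one more derivative), the argument of the pointwise certificate `σ`. -/
def jet4 (v : EuclideanSpace ℝ (Fin 3) → EuclideanSpace ℝ (Fin 3)) (x : EuclideanSpace ℝ (Fin 3)) :
    EuclideanSpace ℝ (Fin 3) × (EuclideanSpace ℝ (Fin 3) [×1]→L[ℝ] EuclideanSpace ℝ (Fin 3)) × (EuclideanSpace ℝ (Fin 3) [×2]→L[ℝ] EuclideanSpace ℝ (Fin 3)) × (EuclideanSpace ℝ (Fin 3) [×3]→L[ℝ] EuclideanSpace ℝ (Fin 3)) × (EuclideanSpace ℝ (Fin 3) [×4]→L[ℝ] EuclideanSpace ℝ (Fin 3)) :=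
  (v x, iteratedFDeriv ℝ 1 v x, iteratedFDeriv ℝ 2 v x, iteratedFDeriv ℝ 3 v x, iteratedFDeriv ℝ 4 v x)

/-- Continuity of the 4-jet of a `C^∞` field. -/
theorem continuous_jet4 {v : EuclideanSpace ℝ (Fin 3) → EuclideanSpace ℝ (Fin 3)} (hv : ContDiff ℝ (⊤ : ℕ∞) v) :
    Continuous (jet4 v) := by
  have hc : ∀ n : ℕ, Continuous fun x => iteratedFDeriv ℝ n v x := fun n =>
    hv.continuous_iteratedFDeriv (by exact_mod_cast le_top)
  have h0 : Continuous v := hv.continuous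
  unfold jet4
  exact h0.prodMk ((hc 1).prodMk ((hc 2).prodMk ((hc 3).prodMk (hc 4))))

/-- **Birth composition (the skeleton theorem).** The crux BY NAME from the three registered stubs, used by name:
certificate ⟶ (decay ⟶ flux transfer) gives `Q_m = ∫ σ ≥ 0` on every divergence-free Schwartz field, and `> 0` at the
strictness witness by continuity and open-support positivity. Real glue, no placeholder outside the stubs. -/
theorem OddMorawetzLocal_of : Theses.OddMorawetz.OddMorawetzLocal := by
  have hJ : ∀ v x, jet3 v x = (v x, iteratedFDeriv ℝ 1 v x, iteratedFDeriv ℝ 2 v x, iteratedFDeriv ℝ 3 v x) :=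
    fun v x => rfl
  have hJ4 : ∀ v x, jet4 v x = (v x, iteratedFDeriv ℝ 1 v x, iteratedFDeriv ℝ 2 v x, iteratedFDeriv ℝ 3 v x,
      iteratedFDeriv ℝ 4 v x) := fun v x => rfl
  -- the certificate
  obtain ⟨k, m, σ, Φ, hk, hm, hhom, hbi, hσs, hΦs, hσ, hid, v₀, hv₀, hd₀, x₀, hpos⟩ :=
    stub_localCertificate jet3 jet4 hJ hJ4
  -- the Euler derivative of `m` is the integral of the certificate on every divergence-free Schwartz field
  have hrep : ∀ v, IsSchwartzField v → VectorCalculus.IsDivFree v →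
      Integrable (fun x => σ (jet4 v x, jet4 (eulerBilinear v v) x)) ∧
        -∫ x, fderiv ℝ m (jet3 v x) (jet3 (eulerBilinear v v) x) =
          ∫ x, σ (jet4 v x, jet4 (eulerBilinear v v) x) := by
    intro v hv hd
    obtain ⟨hb, hdec⟩ := stub_jetDecay v hv hd
    exact stub_fluxTransfer jet3 jet4 hJ hJ4 m σ Φ v (eulerBilinear v v) hm hσs hΦs hσ hv hb hdec (hid v hv hd)
  refine ⟨k, m, ?_⟩
  intro J Q
  refine ⟨hk, hm, hhom, hbi, ?_, v₀, hv₀, hd₀, ?_⟩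
  · -- the sign: `Q v = ∫ σ ≥ 0`
    intro v hv hd
    obtain ⟨hint, hQ⟩ := hrep v hv hd
    have h0 : 0 ≤ ∫ x, σ (jet4 v x, jet4 (eulerBilinear v v) x) := integral_nonneg fun x => hσ _
    rw [← hQ] at h0
    exact h0
  · -- strictness at `v₀`: continuous nonnegative integrand, positive at `x₀`
    obtain ⟨hint, hQ⟩ := hrep v₀ hv₀ hd₀
    have hvs : ContDiff ℝ (⊤ : ℕ∞) v₀ := ((isSchwartzField_iff v₀).1 hv₀).1
    have hbs : ContDiff ℝ (⊤ : ℕ∞) (eulerBilinear v₀ v₀) := (stub_jetDecay v₀ hv₀ hd₀).1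
    have hcont : Continuous fun x => σ (jet4 v₀ x, jet4 (eulerBilinear v₀ v₀) x) :=
      hσs.continuous.comp ((continuous_jet4 hvs).prodMk (continuous_jet4 hbs))
    have hposI : 0 < ∫ x, σ (jet4 v₀ x, jet4 (eulerBilinear v₀ v₀) x) := by
      rw [integral_pos_iff_support_of_nonneg (fun x => hσ _) hint]
      exact hcont.isOpen_support.measure_pos volume ⟨x₀, hpos.ne'⟩
    rw [← hQ] at hposI
    exact hposI

end Summit.NavierStokesRegularity.NavierStokesRegularity.Cruxes.OddMorawetzLocal.Birth
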